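import Mathlib
import HarnessLib
import Summits.HubbardSuperconductivity.HubbardSuperconductivity.Theorems.KLProgrammeThinLevelSetTripleCountIndef
import Summits.HubbardSuperconductivity.HubbardSuperconductivity.Theorems.KLProgrammeAbsUmklappSectorGrid

/-!
# Route `KLProgramme` — K3 engine (stmt-HubbardSuperconductivity-20437), stub (b) (ℓ)/(I2)–(I3), located item «ABS-UMK-COUNT» / «ABS-UMK-34-SIGNPAT»:
# the LABEL-TRIPLE COUNT with a MIXED sign pattern — two labels in the cone at `θ⋆`, the third in the cone at `θ⋆ + π`

Cell gate-hubbard-kl, seat p4 g16 (mixed-sign twin of `card_labelTriples_le`, p617463).  Combine the indefinite brick `ThinLevelSet.card_tripleWindowIndef_le`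
(triples over `G × G × G′` of `h`-separated bounded reals in the windows `|a + b − g − τ| ≤ δ_t`, `|f a + f b − f g − β| ≤ δ_n`) with the sector grid lemma
(`sectorGrid_chart_*`) run at the two centres `θ⋆` (legs `a, b`) and `θ⋆ + π` (leg `c`): with the chart values `u(ω) = U(rep(θ_{n,ω} − θ⋆))`,
`u′(ω) = U(rep(θ_{n,ω} − θ⋆ − π))`,

* **`card_labelTriplesMixed_le`** — the number of label triples `(ω_a, ω_b, ω_c)` of scale `n` with `ω_a, ω_b` within torus distance `Ψ` of `θ⋆`, `ω_c` within
  `Ψ` of `θ⋆ + π`, `|u(ω_a) + u(ω_b) − u′(ω_c) − τ| ≤ δ_t` and `|f(u(ω_a)) + f(u(ω_b)) − f(u′(ω_c)) − β| ≤ δ_n` is at most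
  `(2δ_t/h + 1)·(4(2MΨ/h + 1) + (4(δ_n + Bδ_t)/(c h²))·(1 + log((4MΨ + δ_t)/h + 1)))`, `h = m·w_n`, for any chart coordinate `U` (bi-Lipschitz on
  `[−Φ, Φ] ⊇ [−Ψ, Ψ]`, `U 0 = 0`) and any `f` with `c ≤ f″`, `|f′| ≤ B` on `[−Λ, Λ]`, `Λ ≥ 5MΨ + δ_t` — ONE logarithm, curvature floor only.

Everything is PROVED; no definitions, no named facts. [folklore]
-/

noncomputable section

open Real Set
open Literature.MathematicalPhysics.QuantumLattice Literature.MathematicalPhysics.QuantumLattice.FermiRG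
open Summit.HubbardSuperconductivity.HubbardSuperconductivity.Theorems.ThinLevelSet

namespace Summit.HubbardSuperconductivity.HubbardSuperconductivity.Theorems.AbsUmklappCount

set_option linter.dupNamespace false -- summit = problem name (single-conjunct summit), D-0017

open Classical in
/-- **The label-triple count, mixed signs.**  See the module docstring. [folklore] -/
theorem card_labelTriplesMixed_le {U f f' f'' : ℝ → ℝ} {Φ Ψ m M Λ c B δt δn : ℝ}
    (hm : 0 < m) (hM : 0 ≤ M) (hΦ : 0 ≤ Φ) (hΨ : 0 ≤ Ψ) (hΨΦ : Ψ ≤ Φ)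
    (hlow : ∀ φ ∈ Icc (-Φ) Φ, ∀ φ' ∈ Icc (-Φ) Φ, m * |φ - φ'| ≤ |U φ - U φ'|)
    (hup : ∀ φ ∈ Icc (-Φ) Φ, ∀ φ' ∈ Icc (-Φ) Φ, |U φ - U φ'| ≤ M * |φ - φ'|) (hU0 : U 0 = 0)
    (hc : 0 < c) (hB : 0 ≤ B) (hδt : 0 ≤ δt) (hδn : 0 ≤ δn) (n : ℕ)
    (hΛ : 5 * (M * Ψ) + δt ≤ Λ)
    (hf : ∀ x ∈ Icc (-Λ) Λ, HasDerivAt f (f' x) x) (hf' : ∀ x ∈ Icc (-Λ) Λ, HasDerivAt f' (f'' x) x)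
    (hfloor : ∀ x ∈ Icc (-Λ) Λ, c ≤ f'' x) (hder : ∀ x ∈ Icc (-Λ) Λ, |f' x| ≤ B)
    (θs τ β : ℝ) :
    (((Finset.univ : Finset ((Fin (sectorCount n) × Fin (sectorCount n)) × Fin (sectorCount n))).filter
        fun t => torusDist (sectorCenter n t.1.1 - θs) ≤ Ψ ∧ torusDist (sectorCenter n t.1.2 - θs) ≤ Ψ ∧
          torusDist (sectorCenter n t.2 - (θs + π)) ≤ Ψ ∧
          |U (sectorCenter n t.1.1 - θs - round ((2 * π)⁻¹ * (sectorCenter n t.1.1 - θs)) * (2 * π)) +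
              U (sectorCenter n t.1.2 - θs - round ((2 * π)⁻¹ * (sectorCenter n t.1.2 - θs)) * (2 * π)) -
              U (sectorCenter n t.2 - (θs + π) - round ((2 * π)⁻¹ * (sectorCenter n t.2 - (θs + π))) * (2 * π)) - τ| ≤ δt ∧
          |f (U (sectorCenter n t.1.1 - θs - round ((2 * π)⁻¹ * (sectorCenter n t.1.1 - θs)) * (2 * π))) +
              f (U (sectorCenter n t.1.2 - θs - round ((2 * π)⁻¹ * (sectorCenter n t.1.2 - θs)) * (2 * π))) -
              f (U (sectorCenter n t.2 - (θs + π) - round ((2 * π)⁻¹ * (sectorCenter n t.2 - (θs + π))) * (2 * π))) - β| ≤ δn).card : ℝ) ≤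
      (2 * δt / (m * sectorWidth n) + 1) *
        (4 * (2 * (M * Ψ) / (m * sectorWidth n) + 1) +
          4 * (δn + B * δt) / (c * (m * sectorWidth n) ^ 2) * (1 + Real.log ((4 * (M * Ψ) + δt) / (m * sectorWidth n) + 1))) := by
  set N := sectorCount n with hN
  set w := sectorWidth n with hw
  have hwpos : 0 < w := sectorWidth_pos n
  set h := m * w with hh
  have hhpos : 0 < h := mul_pos hm hwpos
  -- the chart values of a label, read from `θ⋆` and from `θ⋆ + π`
  set uo : Fin N → ℝ := fun ω => U (sectorCenter n ω - θs - round ((2 * π)⁻¹ * (sectorCenter n ω - θs)) * (2 * π)) with huo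
  set uo' : Fin N → ℝ := fun ω => U (sectorCenter n ω - (θs + π) - round ((2 * π)⁻¹ * (sectorCenter n ω - (θs + π))) * (2 * π)) with huo'
  -- the two grids of chart values
  set S : Finset (Fin N) := Finset.univ.filter fun ω => torusDist (sectorCenter n ω - θs) ≤ Ψ with hS
  set S' : Finset (Fin N) := Finset.univ.filter fun ω => torusDist (sectorCenter n ω - (θs + π)) ≤ Ψ with hS'
  set G : Finset ℝ := S.image uo with hG
  set G' : Finset ℝ := S'.image uo' with hG'
  have hmemS : ∀ ω, ω ∈ S ↔ torusDist (sectorCenter n ω - θs) ≤ Ψ := fun ω => by rw [hS]; simp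
  have hmemS' : ∀ ω, ω ∈ S' ↔ torusDist (sectorCenter n ω - (θs + π)) ≤ Ψ := fun ω => by rw [hS']; simp
  have hGb : ∀ g ∈ G, |g| ≤ M * Ψ := by
    intro g hg
    rw [hG, Finset.mem_image] at hg
    obtain ⟨ω, hω, rfl⟩ := hg
    exact sectorGrid_chart_bounded hM hΦ hΨΦ hup hU0 (abs_rep_le_of_torusDist_le ((hmemS ω).1 hω))
  have hGb' : ∀ g ∈ G', |g| ≤ M * Ψ := by
    intro g hg
    rw [hG', Finset.mem_image] at hg
    obtain ⟨ω, hω, rfl⟩ := hg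
    exact sectorGrid_chart_bounded hM hΦ hΨΦ hup hU0 (abs_rep_le_of_torusDist_le ((hmemS' ω).1 hω))
  have hrepI : ∀ ω ∈ S, sectorCenter n ω - θs - round ((2 * π)⁻¹ * (sectorCenter n ω - θs)) * (2 * π) ∈ Icc (-Φ) Φ := by
    intro ω hω
    have := abs_le.1 ((abs_rep_le_of_torusDist_le ((hmemS ω).1 hω)).trans hΨΦ)
    exact ⟨this.1, this.2⟩
  have hrepI' : ∀ ω ∈ S', sectorCenter n ω - (θs + π) - round ((2 * π)⁻¹ * (sectorCenter n ω - (θs + π))) * (2 * π) ∈ Icc (-Φ) Φ := by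
    intro ω hω
    have := abs_le.1 ((abs_rep_le_of_torusDist_le ((hmemS' ω).1 hω)).trans hΨΦ)
    exact ⟨this.1, this.2⟩
  have hGsep : ∀ g ∈ G, ∀ g' ∈ G, g ≠ g' → h ≤ |g - g'| := by
    intro g hg g' hg' hne
    rw [hG, Finset.mem_image] at hg hg'
    obtain ⟨ω, hω, rfl⟩ := hg
    obtain ⟨ω', hω', rfl⟩ := hg'
    have hne' : (ω : ℕ) ≠ (ω' : ℕ) := by
      intro heq; exact hne (by rw [Fin.ext heq])
    exact sectorGrid_chart_separated hm.le hlow n θs ω.isLt ω'.isLt hne' (hrepI ω hω) (hrepI ω' hω')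
  have hGsep' : ∀ g ∈ G', ∀ g' ∈ G', g ≠ g' → h ≤ |g - g'| := by
    intro g hg g' hg' hne
    rw [hG', Finset.mem_image] at hg hg'
    obtain ⟨ω, hω, rfl⟩ := hg
    obtain ⟨ω', hω', rfl⟩ := hg'
    have hne' : (ω : ℕ) ≠ (ω' : ℕ) := by
      intro heq; exact hne (by rw [Fin.ext heq])
    exact sectorGrid_chart_separated hm.le hlow n (θs + π) ω.isLt ω'.isLt hne' (hrepI' ω hω) (hrepI' ω' hω')
  -- the injection into the triples of the indefinite brick
  set T := ((Finset.univ : Finset ((Fin N × Fin N) × Fin N)).filter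
        fun t => torusDist (sectorCenter n t.1.1 - θs) ≤ Ψ ∧ torusDist (sectorCenter n t.1.2 - θs) ≤ Ψ ∧
          torusDist (sectorCenter n t.2 - (θs + π)) ≤ Ψ ∧
          |uo t.1.1 + uo t.1.2 - uo' t.2 - τ| ≤ δt ∧ |f (uo t.1.1) + f (uo t.1.2) - f (uo' t.2) - β| ≤ δn) with hT
  set T' := ((G ×ˢ G) ×ˢ G').filter fun t : (ℝ × ℝ) × ℝ =>
      |t.1.1 + t.1.2 - t.2 - τ| ≤ δt ∧ |f t.1.1 + f t.1.2 - f t.2 - β| ≤ δn with hT'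
  set e : (Fin N × Fin N) × Fin N → (ℝ × ℝ) × ℝ := fun t => ((uo t.1.1, uo t.1.2), uo' t.2) with he
  have hinjS : Set.InjOn uo {ω : Fin N | torusDist (sectorCenter n ω - θs) ≤ Ψ} :=
    sectorGrid_chart_injOn hm hΨΦ hlow n θs
  have hinjS' : Set.InjOn uo' {ω : Fin N | torusDist (sectorCenter n ω - (θs + π)) ≤ Ψ} :=
    sectorGrid_chart_injOn hm hΨΦ hlow n (θs + π)
  have hmaps : Set.MapsTo e T T' := by
    intro t ht
    have ht' : t ∈ T := by simpa using ht
    rw [hT, Finset.mem_filter] at ht'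
    obtain ⟨-, h1, h2, h3, h4, h5⟩ := ht'
    have hm1 : uo t.1.1 ∈ G := by rw [hG]; exact Finset.mem_image_of_mem _ ((hmemS _).2 h1)
    have hm2 : uo t.1.2 ∈ G := by rw [hG]; exact Finset.mem_image_of_mem _ ((hmemS _).2 h2)
    have hm3 : uo' t.2 ∈ G' := by rw [hG']; exact Finset.mem_image_of_mem _ ((hmemS' _).2 h3)
    show e t ∈ (T' : Set ((ℝ × ℝ) × ℝ))
    rw [Finset.mem_coe, hT', Finset.mem_filter, Finset.mem_product, Finset.mem_product]
    exact ⟨⟨⟨hm1, hm2⟩, hm3⟩, h4, h5⟩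
  have hinj : Set.InjOn e T := by
    intro t ht t' ht' hee
    have ht1 : t ∈ T := by simpa using ht
    have ht2 : t' ∈ T := by simpa using ht'
    rw [hT, Finset.mem_filter] at ht1 ht2
    obtain ⟨-, h1, h2, h3, -, -⟩ := ht1
    obtain ⟨-, h1', h2', h3', -, -⟩ := ht2
    rw [he] at hee
    simp only [Prod.mk.injEq] at hee
    obtain ⟨⟨e1, e2⟩, e3⟩ := hee
    have q1 := hinjS h1 h1' e1
    have q2 := hinjS h2 h2' e2
    have q3 := hinjS' h3 h3' e3
    exact Prod.ext (Prod.ext q1 q2) q3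
  have hcard : T.card ≤ T'.card := Finset.card_le_card_of_injOn e hmaps hinj
  have hT'card := card_tripleWindowIndef_le (ρ₀ := M * Ψ) (by positivity) hhpos hc hB hδt hδn hΛ
    hf hf' hfloor hder G hGb hGsep G' hGb' hGsep' τ β
  have h1 : (T.card : ℝ) ≤ (T'.card : ℝ) := by exact_mod_cast hcard
  exact h1.trans hT'card

end Summit.HubbardSuperconductivity.HubbardSuperconductivity.Theorems.AbsUmklappCount

end
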